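import Mathlib
import Summits.ValiantsHypothesis.ValiantsHypothesis.Theorems.NewtonUnitEquationsTwoProductsFormalLogLinearisationDefs
import Summits.ValiantsHypothesis.ValiantsHypothesis.Theorems.NewtonUnitEquationsTwoProductsFormalLogLinearisationLiftedSlotRank
import Summits.ValiantsHypothesis.ValiantsHypothesis.Theorems.NewtonUnitEquationsTwoProductsFormalLogLinearisationTame
import Summits.ValiantsHypothesis.ValiantsHypothesis.Theorems.NewtonUnitEquationsTwoProductsFormalLogLinearisationStubRaysRung
import HarnessLib

/-!
# Crux `TwoProducts` (stmt-ValiantsHypothesis-5906), line `planar_cell`: the abstract planar per-cell count (Theorems port, 1/2)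

Port of the PROVED, LIVE content of val-idea-8's line `Cruxes/TwoProducts/Lines/planar_cell.lean` (v2 @c79afd9dab00) into an
importable module (val-lit-p3 g13; desk RULINGS #133/#145, `--supports stmt-ValiantsHypothesis-5906 --as helper`).  This file
carries, VERBATIM (namespace `Cruxes.TwoProducts.PlanarCell` ↦ `Theorems.NewtonUnitEquations.TwoProducts.PlanarCell`):

* the objects `lam` (planar image `Λ_E μ = Σ_i μ_i • E_i` of a lifted multi-index) and `tailSupport`;
* the elementary weight / planar-image lemmas (`wt_sum`, `wt_lam`, `lam_add_single`, `lam_single`, `eq_of_nsmul_eq`,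
  `card_support_le_log_of_prod_le`, `apply_lt_of_prod_le`);
* `planarCount_cell` — the abstract planar re-run of `ExpSum.pencilCount_cell`: in one weight-order cell, cross
  representatives of strict tops number `≤ (log₂ n + 1)·n^{log₂ n}·f^{log₂ n}` when every slot is `f`-narrow (SHAPES and
  INJECTIVITY transfer planar-side; the slot width `f` is a parameter).

The companion file `…PlanarCrossQuasiPoly.lean` (2/2) carries the statements `PlanarCross` (SUB₁), `PlanarSlotBound` (SUB₂ —
REFUTED: `Theorems/TwoProducts/Negative/PlanarSlotBoundFalse.lean`, p600147), `quasiPolyCell_of_planarCross` (SUB₁ alone ⇒ a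
quasi-polynomial cell bound, using `planarCount_cell` with the trivial slot width `#tail support`) and the `m = 1` bodies.
NOT ported (dead architecture after the refutation of SUB₂; desk RULING #131): `PlanarCellBound`-split `planarCellBound_of`,
`TwoProducts_of`.  Honest framing: bookkeeping/structure only; SUB₁ `PlanarCross`, `PlanarCellBound`, the engine
`stub_logSumEngine` and the crux `TwoProducts` are OPEN; `VP ≠ VNP` is NOT proved and not moved.  No named facts. [folklore]
-/

noncomputable section

-- Sub = Summit single-conjunct layout: the duplicated namespace component is mandated by the tree.
set_option linter.dupNamespace false

open scoped BigOperators
open MvPolynomial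
open Summit.ValiantsHypothesis.ValiantsHypothesis.Theorems.NewtonUnitEquations.TwoProducts.FormalLogLinearisation

namespace Summit.ValiantsHypothesis.ValiantsHypothesis.Theorems.NewtonUnitEquations.TwoProducts.PlanarCell

/-! ## Objects (verbatim) -/

/-- Planar image `Λ_E(μ) = Σ_i μ_i • E_i` of a lifted multi-index `μ : Fin s → ℕ` along an enumeration `E` of tail
exponents (the monoid map `ℕ^E → ℕ²` of the theory memo §3). -/
def lam {s : ℕ} (E : Fin s → Expo) (μ : Fin s → ℕ) : Expo := ∑ i, μ i • E i

variable {m : ℕ}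

/-- The tail support `⋃_j supp u_j ∪ ⋃_j supp v_j` (verbatim the inline set of `twoProducts_of_planarCellBound`). -/
def tailSupport (u v : Fin m → MvPolynomial (Fin 2) ℂ) : Finset Expo :=
  (Finset.univ.biUnion fun j => (u j).support) ∪ Finset.univ.biUnion fun j => (v j).support

/-! ## Elementary lemmas on weights and planar images (verbatim; `wt_add`, `wt_zero`, `wt_nsmul` are the landed ones of
`…Tame.lean` / `…StubRaysRung.lean`) -/

/-- `wt` of a finite sum. [folklore] -/
theorem wt_sum {ι : Type*} (ξ : Fin 2 → ℝ) (S : Finset ι) (g : ι → Expo) :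
    wt ξ (∑ i ∈ S, g i) = ∑ i ∈ S, wt ξ (g i) := by
  classical
  induction S using Finset.induction_on with
  | empty => simp [wt_zero]
  | insert a S ha ih => rw [Finset.sum_insert ha, Finset.sum_insert ha, wt_add, ih]

/-- `wt ξ (Λ_E μ) = Σ_i μ_i · wt ξ (E i)`. -/
theorem wt_lam {s : ℕ} (ξ : Fin 2 → ℝ) (E : Fin s → Expo) (μ : Fin s → ℕ) :
    wt ξ (lam E μ) = ∑ i, (μ i : ℝ) * wt ξ (E i) := by
  unfold lam
  rw [wt_sum]
  exact Finset.sum_congr rfl fun i _ => wt_nsmul ξ (μ i) (E i)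

/-- `Λ_E (ρ + e·e_j) = Λ_E ρ + e • E_j`. -/
theorem lam_add_single {s : ℕ} (E : Fin s → Expo) (ρ : Fin s → ℕ) (j : Fin s) (e : ℕ) :
    lam E (ρ + (Pi.single j e : Fin s → ℕ)) = lam E ρ + e • E j := by
  classical
  unfold lam
  simp only [Pi.add_apply, add_smul, Finset.sum_add_distrib]
  congr 1
  rw [Finset.sum_eq_single j]
  · simp
  · intro i _ hi; simp [hi]
  · intro h; exact absurd (Finset.mem_univ j) h

set_option linter.unnecessarySimpa false in
/-- `Λ_E (e_j) = E_j`. -/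
theorem lam_single {s : ℕ} (E : Fin s → Expo) (j : Fin s) :
    lam E (Pi.single j 1 : Fin s → ℕ) = E j := by
  have := lam_add_single E 0 j 1
  simpa [lam] using this

/-- Cancelling a positive scalar on exponent vectors. -/
theorem eq_of_nsmul_eq {e : ℕ} (he : 1 ≤ e) {a b : Expo} (h : e • a = e • b) : a = b := by
  ext i
  have := congrArg (fun f : Expo => f i) h
  simp only [Finsupp.coe_smul, Pi.smul_apply, smul_eq_mul] at this
  exact Nat.eq_of_mul_eq_mul_left (by omega) this

/-- Support size from the cross condition: `2^{#supp μ} ≤ ∏ (μ_i + 1) ≤ n` gives `#supp μ ≤ log₂ n`. -/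
theorem card_support_le_log_of_prod_le {s : ℕ} (μ : Fin s → ℕ) (n : ℕ) (h : ∏ i, (μ i + 1) ≤ n) :
    (Finset.univ.filter fun i => μ i ≠ 0).card ≤ Nat.log 2 n := by
  classical
  have hpow : 2 ^ (Finset.univ.filter fun i => μ i ≠ 0).card ≤ ∏ i, (μ i + 1) := by
    calc 2 ^ (Finset.univ.filter fun i => μ i ≠ 0).card
        = ∏ i ∈ Finset.univ.filter (fun i => μ i ≠ 0), 2 := by simp
      _ ≤ ∏ i ∈ Finset.univ.filter (fun i => μ i ≠ 0), (μ i + 1) := by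
          refine Finset.prod_le_prod' fun i hi => ?_
          have := (Finset.mem_filter.mp hi).2
          omega
      _ ≤ ∏ i, (μ i + 1) :=
          Finset.prod_le_prod_of_subset_of_one_le' (Finset.filter_subset _ _) fun i _ _ => Nat.succ_pos _
  exact Nat.le_log_of_pow_le (by norm_num) (hpow.trans h)

/-- Exponents from the cross condition: `μ_i + 1 ∣ ∏ (μ_j + 1) ≤ n` gives `μ_i < n`. -/
theorem apply_lt_of_prod_le {s : ℕ} (μ : Fin s → ℕ) (n : ℕ) (h : ∏ i, (μ i + 1) ≤ n) (i : Fin s) : μ i < n := by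
  have hdvd : (μ i + 1) ∣ ∏ j, (μ j + 1) := Finset.dvd_prod_of_mem (fun j => μ j + 1) (Finset.mem_univ i)
  have hle : μ i + 1 ≤ ∏ j, (μ j + 1) := Nat.le_of_dvd (Finset.prod_pos fun j _ => Nat.succ_pos _) hdvd
  exact Nat.lt_of_lt_of_le (Nat.lt_succ_self _) (hle.trans h)

/-! ## The abstract planar cell count (verbatim; planar re-run of `ExpSum.pencilCount_cell`) -/

/-- **PLANAR PER-CELL COUNT (abstract).**  Let `E : Fin s → ℕ²` be an injective enumeration of exponents, `N ⊆ ℕ²`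
("alive" planar points), `R` a relation on coordinates, and `C` a finite set of lifted multi-indices such that every
`μ ∈ C` lies in the hyperbolic cross `∏ (μ_i + 1) ≤ n` and its planar image `Λ_E μ` is the STRICT `ξ`-top of `N` for
some weight `ξ` inducing `R` on the coordinates (`R j j' ↔ wt ξ E_j ≤ wt ξ E_{j'}`) — a CELL FAMILY of
representatives.  If every SLOT is `f`-narrow — for every `e ≥ 1`, every set `D` of coordinates carrying pairwise
distinct representatives `rep d ∈ C` with `(rep d)_d = e` has `#D ≤ f` — then
`#C ≤ (log₂ n + 1) · n^{log₂ n} · f^{log₂ n}`.  (Shapes `≤ (log₂ n + 1) n^{log₂ n}`; within a shape a member is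
determined by its slots `1, …, L−1`: two members differing only in slot `0` have planar images differing by
`e·(E_j − E_{j'})`, whose weight sign is constant on the cell, so the heavier kills the other's strict top.) -/
theorem planarCount_cell {s : ℕ} (E : Fin s → Expo) (hE : Function.Injective E) (N : Set Expo)
    (R : Fin s → Fin s → Prop) (n f : ℕ) (hf : 1 ≤ f) (C : Finset (Fin s → ℕ))
    (hC : ∀ μ ∈ C, (∏ i, (μ i + 1)) ≤ n ∧ ∃ ξ : Fin 2 → ℝ,
      IsStrictTop ξ N (lam E μ) ∧ ∀ j j' : Fin s, R j j' ↔ wt ξ (E j) ≤ wt ξ (E j'))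
    (hslot : ∀ e : ℕ, 1 ≤ e → ∀ (D : Finset (Fin s)) (rep : Fin s → (Fin s → ℕ)),
      (∀ d ∈ D, rep d ∈ C ∧ rep d d = e) → Set.InjOn rep ↑D → D.card ≤ f) :
    C.card ≤ (Nat.log 2 n + 1) * n ^ Nat.log 2 n * f ^ Nat.log 2 n := by
  classical
  set Lm := Nat.log 2 n with hLm
  -- degenerate cases
  rcases Nat.eq_zero_or_pos n with hn0 | hnpos
  · -- `n = 0`: the cross is empty, so `C = ∅`
    have hC0 : C = ∅ := by
      refine Finset.eq_empty_of_forall_notMem fun μ hμ => ?_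
      have h1 : 1 ≤ ∏ i, (μ i + 1) := Finset.prod_pos fun i _ => Nat.succ_pos _
      have h2 := (hC μ hμ).1
      omega
    simp [hC0]
  rcases Nat.eq_zero_or_pos s with hs0 | hspos
  · -- no coordinates: at most one function `Fin 0 → ℕ`
    subst hs0
    have : C.card ≤ 1 := Finset.card_le_one.2 fun μ _ μ' _ => funext fun i => i.elim0
    calc C.card ≤ 1 := this
      _ ≤ (Lm + 1) * n ^ Lm * f ^ Lm := Nat.one_le_iff_ne_zero.2 (by positivity)
  obtain ⟨i₀⟩ : Nonempty (Fin s) := ⟨⟨0, hspos⟩⟩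
  -- the witnesses
  have hC' : ∀ μ ∈ C, ∃ ξ : Fin 2 → ℝ,
      IsStrictTop ξ N (lam E μ) ∧ ∀ j j' : Fin s, R j j' ↔ wt ξ (E j) ≤ wt ξ (E j') := fun μ hμ => (hC μ hμ).2
  -- structural facts: support and exponents (from the cross condition)
  have hsupp : ∀ μ ∈ C, (Finset.univ.filter fun i => μ i ≠ 0).card ≤ Lm := fun μ hμ =>
    card_support_le_log_of_prod_le μ n (hC μ hμ).1
  have hexp : ∀ μ ∈ C, ∀ i, μ i < n := fun μ hμ i => apply_lt_of_prod_le μ n (hC μ hμ).1 i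
  -- labelling of the support: slot `l` ↦ the `l`-th coordinate of the support (increasing), junk beyond
  let supp : (Fin s → ℕ) → Finset (Fin s) := fun μ => Finset.univ.filter fun i => μ i ≠ 0
  let lab : (Fin s → ℕ) → ℕ → Fin s := fun μ l =>
    if h : l < (supp μ).card then (supp μ).orderEmbOfFin rfl ⟨l, h⟩ else i₀
  have hlab_mem : ∀ μ l, l < (supp μ).card → μ (lab μ l) ≠ 0 := by
    intro μ l hl
    have : lab μ l ∈ supp μ := by
      simp only [lab, dif_pos hl]; exact Finset.orderEmbOfFin_mem _ _ _
    simpa [supp] using this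
  have hlab_inj : ∀ μ l l', l < (supp μ).card → l' < (supp μ).card → lab μ l = lab μ l' → l = l' := by
    intro μ l l' hl hl' h
    simp only [lab, dif_pos hl, dif_pos hl'] at h
    have := ((supp μ).orderEmbOfFin rfl).injective h
    simpa using this
  have hlab_surj : ∀ μ i, μ i ≠ 0 → ∃ l, l < (supp μ).card ∧ lab μ l = i := by
    intro μ i hi
    have hi' : i ∈ supp μ := by simpa [supp] using hi
    have : i ∈ Set.range ((supp μ).orderEmbOfFin rfl) := by
      rw [Finset.range_orderEmbOfFin]; exact hi'
    obtain ⟨⟨l, hl⟩, hl'⟩ := this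
    exact ⟨l, hl, by simp only [lab, dif_pos hl]; exact hl'⟩
  -- the shape key
  let key : (Fin s → ℕ) → ℕ × (Fin Lm → ℕ) := fun μ =>
    ((supp μ).card, fun l => if (l : ℕ) < (supp μ).card then μ (lab μ l) else 0)
  have hkey_img : C.image key ⊆ (Finset.range (Lm + 1)) ×ˢ (Fintype.piFinset fun _ : Fin Lm => Finset.range n) := by
    intro k hk
    obtain ⟨μ, hμ, rfl⟩ := Finset.mem_image.1 hk
    refine Finset.mem_product.2 ⟨Finset.mem_range.2 (Nat.lt_succ_of_le (hsupp μ hμ)), ?_⟩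
    refine Fintype.mem_piFinset.2 fun l => Finset.mem_range.2 ?_
    simp only [key]
    split_ifs
    · exact hexp μ hμ _
    · exact hnpos
  have hkey_card : (C.image key).card ≤ (Lm + 1) * n ^ Lm := by
    refine (Finset.card_le_card hkey_img).trans ?_
    rw [Finset.card_product, Finset.card_range, Fintype.card_piFinset, Finset.prod_const, Finset.card_range,
      Finset.card_univ, Fintype.card_fin]
  -- fibre bound
  have hfib : ∀ k ∈ C.image key, (C.filter fun μ => key μ = k).card ≤ f ^ Lm := by
    intro k hk
    obtain ⟨μ₀, hμ₀, rfl⟩ := Finset.mem_image.1 hk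
    set L := (supp μ₀).card with hL
    set G := C.filter fun μ => key μ = key μ₀ with hG
    have hGmem : ∀ μ ∈ G, μ ∈ C ∧ (supp μ).card = L ∧ ∀ l, l < L → μ (lab μ l) = μ₀ (lab μ₀ l) := by
      intro μ hμ
      obtain ⟨hμC, hk⟩ := Finset.mem_filter.1 hμ
      have h1 : (supp μ).card = L := by simpa [key] using congrArg Prod.fst hk
      refine ⟨hμC, h1, fun l hl => ?_⟩
      have hlLm : l < Lm := lt_of_lt_of_le hl (hL ▸ hsupp μ₀ hμ₀)
      have h2 := congrFun (congrArg Prod.snd hk) ⟨l, hlLm⟩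
      simpa [key, h1, hl, ← hL] using h2
    have hLle : L ≤ Lm := hsupp μ₀ hμ₀
    -- slot sets are `f`-narrow (hypothesis `hslot`)
    have hslot' : ∀ l, l < L → (G.image fun μ => lab μ l).card ≤ f := by
      intro l hl
      set e := μ₀ (lab μ₀ l) with he
      have he1 : 1 ≤ e := Nat.one_le_iff_ne_zero.2 (hlab_mem μ₀ l (hL ▸ hl))
      have hrepex : ∀ d ∈ G.image (fun μ => lab μ l), ∃ μ ∈ G, lab μ l = d := fun d hd => by
        simpa only [Finset.mem_image] using hd
      choose! rep hrepG hrepl using hrepex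
      refine hslot e he1 _ rep (fun d hd => ⟨(hGmem _ (hrepG d hd)).1, ?_⟩) ?_
      · have := (hGmem _ (hrepG d hd)).2.2 l hl
        rw [hrepl d hd] at this
        exact this
      · intro d hd d' hd' h
        have h1 := hrepl d hd
        have h2 := hrepl d' hd'
        rw [← h1, ← h2, h]
    -- a member is determined by its slots `1, …, L-1`
    have hinj : Set.InjOn (fun μ => fun l : Fin (L - 1) => lab μ ((l : ℕ) + 1)) ↑G := by
      intro μ hμ μ' hμ' hEq
      obtain ⟨hμC, hμL, hμσ⟩ := hGmem μ hμ
      obtain ⟨hμ'C, hμ'L, hμ'σ⟩ := hGmem μ' hμ'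
      have htail : ∀ l, 1 ≤ l → l < L → lab μ l = lab μ' l := by
        intro l h1 hl
        have := congrFun hEq ⟨l - 1, by omega⟩
        simpa [Nat.sub_add_cancel h1] using this
      rcases Nat.eq_zero_or_pos L with hL0 | hLpos
      · -- empty support: both are zero
        funext i
        have h1 : μ i = 0 := by
          by_contra h
          obtain ⟨l, hl, -⟩ := hlab_surj μ i h
          omega
        have h2 : μ' i = 0 := by
          by_contra h
          obtain ⟨l, hl, -⟩ := hlab_surj μ' i h
          omega
        rw [h1, h2]
      set j := lab μ 0 with hj
      set j' := lab μ' 0 with hj'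
      set e := μ₀ (lab μ₀ 0) with he
      -- common values off `{j, j'}`
      have hval : ∀ i, i ≠ j → i ≠ j' → μ i = μ' i := by
        intro i hij hij'
        by_cases hi : μ i = 0
        · by_cases hi' : μ' i = 0
          · rw [hi, hi']
          · exfalso
            obtain ⟨l, hl, hli⟩ := hlab_surj μ' i hi'
            have hl1 : 1 ≤ l := by
              by_contra h0
              have hl0 : l = 0 := by omega
              subst hl0
              exact hij' hli.symm
            have hlabμ : lab μ l = i := by rw [htail l hl1 (by omega), hli]
            have := hlab_mem μ l (by omega)
            rw [hlabμ] at this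
            exact this hi
        · obtain ⟨l, hl, hli⟩ := hlab_surj μ i hi
          have hl1 : 1 ≤ l := by
            by_contra h0
            have hl0 : l = 0 := by omega
            subst hl0
            exact hij hli.symm
          have hli' : lab μ' l = i := by rw [← htail l hl1 (by omega), hli]
          have h1 := hμσ l (by omega)
          have h2 := hμ'σ l (by omega)
          rw [hli] at h1
          rw [hli'] at h2
          rw [h1, h2]
      have hμj : μ j = e := hμσ 0 (by omega)
      have hμ'j' : μ' j' = e := hμ'σ 0 (by omega)
      have he1 : 1 ≤ e := by
        rw [← hμj]; exact Nat.one_le_iff_ne_zero.2 (hlab_mem μ 0 (by omega))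
      -- if `j = j'` the points coincide
      by_cases hjj : j = j'
      · funext i
        by_cases hij : i = j
        · rw [hij, hμj]
          rw [hjj, hμ'j']
        · exact hval i hij (fun h => hij (h.trans hjj.symm))
      -- otherwise `μ' j = 0` and `μ j' = 0`
      have hμ'j : μ' j = 0 := by
        by_contra h
        obtain ⟨l, hl, hli⟩ := hlab_surj μ' j h
        by_cases hl0 : l = 0
        · subst hl0
          exact hjj hli.symm
        · have hlabμ : lab μ l = lab μ 0 := by rw [htail l (by omega) (by omega), hli]
          have := hlab_inj μ l 0 (by omega) (by omega) hlabμ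
          exact hl0 this
      have hμj' : μ j' = 0 := by
        by_contra h
        obtain ⟨l, hl, hli⟩ := hlab_surj μ j' h
        by_cases hl0 : l = 0
        · subst hl0
          exact hjj hli
        · have hlabμ' : lab μ' l = lab μ' 0 := by rw [← htail l (by omega) (by omega), hli]
          have := hlab_inj μ' l 0 (by omega) (by omega) hlabμ'
          exact hl0 this
      -- `μ = ρ + e e_j`, `μ' = ρ + e e_{j'}` with the common remainder `ρ`
      set ρ : Fin s → ℕ := Function.update μ j 0 with hρ
      have hμρ : μ = ρ + (Pi.single j e : Fin s → ℕ) := by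
        rw [← hμj]; exact (ExpSum.update_add_single μ j).symm
      have hμ'ρ : μ' = ρ + (Pi.single j' e : Fin s → ℕ) := by
        funext i
        by_cases hij' : i = j'
        · subst hij'
          simp [hρ, Function.update_of_ne (Ne.symm hjj), hμj', hμ'j']
        · by_cases hij : i = j
          · subst hij
            simp [hρ, hμ'j, hij']
          · simp [hρ, Function.update_of_ne hij, hij', hval i hij hij']
      -- planar images: `Λ μ = Λ ρ + e E_j`, `Λ μ' = Λ ρ + e E_{j'}`, distinct since `E` is injective
      have hLμ : lam E μ = lam E ρ + e • E j := by rw [hμρ, lam_add_single]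
      have hLμ' : lam E μ' = lam E ρ + e • E j' := by rw [hμ'ρ, lam_add_single]
      have hne : lam E μ ≠ lam E μ' := by
        intro h
        rw [hLμ, hLμ'] at h
        have h' : e • E j = e • E j' := add_left_cancel h
        exact hjj (hE (eq_of_nsmul_eq he1 h'))
      obtain ⟨ξ, hvis, hR⟩ := hC' μ hμC
      obtain ⟨ξ', hvis', hR'⟩ := hC' μ' hμ'C
      have hNμ : lam E μ ∈ N := hvis.1
      have hNμ' : lam E μ' ∈ N := hvis'.1
      have hwμ : ∀ ζ : Fin 2 → ℝ, wt ζ (lam E μ) = wt ζ (lam E ρ) + (e : ℝ) * wt ζ (E j) := fun ζ => by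
        rw [hLμ, wt_add, wt_nsmul]
      have hwμ' : ∀ ζ : Fin 2 → ℝ, wt ζ (lam E μ') = wt ζ (lam E ρ) + (e : ℝ) * wt ζ (E j') := fun ζ => by
        rw [hLμ', wt_add, wt_nsmul]
      exfalso
      have hepos : (0 : ℝ) ≤ (e : ℝ) := by positivity
      rcases le_total (wt ξ' (E j')) (wt ξ' (E j)) with hle | hle
      · -- at `ξ'`, `Λ μ` is at least as heavy as `Λ μ'`: contradicts the strict top `Λ μ'`
        have hlt := hvis'.2 (lam E μ) hNμ hne
        have := mul_le_mul_of_nonneg_left hle hepos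
        rw [hwμ ξ', hwμ' ξ'] at hlt
        linarith
      · -- `R j j'`, so at `ξ` too `wt E_j ≤ wt E_{j'}`: `Λ μ'` is at least as heavy as `Λ μ` at `ξ`
        have hle' : wt ξ (E j) ≤ wt ξ (E j') := (hR _ _).1 ((hR' _ _).2 hle)
        have hlt := hvis.2 (lam E μ') hNμ' (Ne.symm hne)
        have := mul_le_mul_of_nonneg_left hle' hepos
        rw [hwμ ξ, hwμ' ξ] at hlt
        linarith
    -- count the fibre through the injection into `∏_{l < L-1} (slot set l+1)`
    have himg : G.image (fun μ => fun l : Fin (L - 1) => lab μ ((l : ℕ) + 1)) ⊆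
        Fintype.piFinset fun l : Fin (L - 1) => G.image fun μ => lab μ ((l : ℕ) + 1) := by
      intro g hg
      obtain ⟨μ, hμ, rfl⟩ := Finset.mem_image.1 hg
      exact Fintype.mem_piFinset.2 fun l => Finset.mem_image_of_mem _ hμ
    calc G.card = (G.image fun μ => fun l : Fin (L - 1) => lab μ ((l : ℕ) + 1)).card :=
          (Finset.card_image_of_injOn hinj).symm
      _ ≤ (Fintype.piFinset fun l : Fin (L - 1) => G.image fun μ => lab μ ((l : ℕ) + 1)).card :=
          Finset.card_le_card himg
      _ = ∏ l : Fin (L - 1), (G.image fun μ => lab μ ((l : ℕ) + 1)).card := Fintype.card_piFinset _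
      _ ≤ ∏ _l : Fin (L - 1), f := Finset.prod_le_prod' fun l _ => hslot' _ (by omega)
      _ = f ^ (L - 1) := by simp
      _ ≤ f ^ Lm := Nat.pow_le_pow_right hf (by omega)
  -- assemble
  calc C.card ≤ f ^ Lm * (C.image key).card := Finset.card_le_mul_card_image C _ hfib
    _ ≤ f ^ Lm * ((Lm + 1) * n ^ Lm) := Nat.mul_le_mul_left _ hkey_card
    _ = (Lm + 1) * n ^ Lm * f ^ Lm := by ring

end Summit.ValiantsHypothesis.ValiantsHypothesis.Theorems.NewtonUnitEquations.TwoProducts.PlanarCell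

end
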